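import Summits.QuantumAdvantage.AdviceFreeQNC0.AffBells36PairSliceS3
import HarnessLib

/-!
# AffBells36 — `PairAlignedHard` PROVED by pair slicing (planner qa-qnc0-p1 g36, ROUND-35 §4.5–4.6; ask P-36d)

The planner's skeleton `HOME/qa-qnc0-p1/exp36/PairSliceSkeleton36.lean` (stubs S1–S5 + the composition
`pairAlignedHard_of`, with S1/S2/S5 proved there by the planner) is repeated VERBATIM for S1/S2/S5 and the composition; S3 and
S4 are the prover's `AffBells36PairSliceS3.s3_holds` / `AffBells36PairSliceS4.s4_holds`.  Final theorem:
`AffBells36.PairSkel.pairAlignedHard : PairAlignedHard` — the ANALYTIC BOX of ROUND-35 in alignment form is a tree theorem: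
an affine MOD₃ bell strategy whose rows are aligned with a common `γ` at all but `(log₂ N)^C` pairs of a linear adjacent pairing
wins at most `θ·2^{N−1}` odd inputs.  Prover qn-prover-3 g20 (ports + S3/S4); planner qa-qnc0-p1 g36 (statements, S1/S2/S5,
composition).  Serves stmt-QuantumAdvantage-22907 (untagged: the gate refuses `--supports` across sub-problems).
WHAT THIS IS NOT: the structural box `NearPerfectAligned` (near-perfect ⇒ aligned) remains OPEN; with it `polyLoss_of_alignment`
(AffBells36PairSlice) gives (NP₁) `AffBellsPolyLoss3`.
-/

noncomputable section

open Classical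

namespace Summit.QuantumAdvantage.AdviceFreeQNC0.AffBells36

open Finset Literature.Computability.QuantumComplexity Literature.Computability.QuantumComplexity.RingHLF
open Literature.Computability.MetaComplexity Literature.Computability.MetaComplexity.Smolensky
open AffBells22 AffBells23 AffBells26

namespace PairSkel



variable {n : ℕ}

/-- S1: odd wins inject into walk wins. -/
def S1 : Prop := ∀ n : ℕ, 2 ≤ n → ∀ (β : Fin (n + 1) → Fin (n + 1) → ZMod 3) (c : Fin (n + 1) → ZMod 3),
  affWinCard β c ≤ (univ.filter fun u : Fin n → Bool => ringWinU (n + 2) (yOf β c) u = true).card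

/-- S2: the free set reads the walk point off the pair-firsts only. -/
def S2 : Prop := ∀ n : ℕ, ∀ (γ : Fin (n + 1) → ZMod 3) (P : Finset (Fin (n + 1))), IsPairing P →
  ∀ a a' : Fin n → Bool, (∀ i, i ∉ firsts P → a i = a' i) → freeSet γ P a = freeSet γ P a'

/-- S5: value-refined slicing sum. -/
def S5 : Prop := ∀ n : ℕ, ∀ (Q : (Fin n → Bool) → Prop) [DecidablePred Q] (S₀ : Finset (Fin n))
  (Sf : (Fin n → Bool) → Finset (Fin n)) (good : (Fin n → Bool) → Prop) [DecidablePred good] (θ : ℝ), 0 ≤ θ →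
  (∀ a, S₀ ⊆ Sf a) → (∀ a a', (∀ i ∈ S₀, a i = a' i) → Sf a = Sf a' ∧ (good a ↔ good a')) →
  (∀ a, good a → ((univ.filter fun u => Q (subcubeMerge (Sf a) a u)).card : ℝ) ≤ θ * (2 : ℝ) ^ n) →
    ((univ.filter Q).card : ℝ) ≤ θ * (2 : ℝ) ^ n + ((univ.filter fun a => ¬ good a).card : ℝ)

/-- **S1 PROVED** (transport count; = the `hodd` block of `ringHard_two_of_walkHard`). -/
theorem S1_holds : S1 := by
  intro n hn β c
  unfold affWinCard
  refine Finset.card_le_card_of_injOn uVec ?_ ?_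
  · intro x hx
    rw [Finset.mem_coe, mem_filter] at hx
    rw [Finset.mem_coe, mem_filter]
    have hodd : (univ.filter fun j : Fin (n + 1) => x j = false).card % 2 = 1 := hx.2.1
    exact ⟨mem_univ _, (rel_iff_ringWinU hn x hodd (affBell β c)).1 hx.2.2⟩
  · intro x₁ hx₁ x₂ hx₂ h
    rw [Finset.mem_coe, mem_filter] at hx₁ hx₂
    have h1 : (univ.filter fun j : Fin (n + 1) => x₁ j = false).card % 2 = 1 := hx₁.2.1
    have h2 : (univ.filter fun j : Fin (n + 1) => x₂ j = false).card % 2 = 1 := hx₂.2.1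
    rw [← xOfU_uVec hn x₁ h1, ← xOfU_uVec hn x₂ h2, h]

/-- **S2 PROVED** (free-set locality). -/
theorem S2_holds : S2 := by
  intro n γ P hP a a' h
  have hnot : ∀ k : Fin n, k.castSucc ∈ P → ∀ k' : Fin n, k'.val = k.val + 1 → k' ∉ firsts P := by
    intro k hk k' hk' hmem
    unfold firsts at hmem; rw [mem_filter] at hmem
    exact (hP _ hk).2 _ hmem.2 (by simp [hk'])
  have hnot' : ∀ k : Fin n, k.castSucc ∈ P → ∀ k' : Fin n, k.val = k'.val + 1 → k' ∉ firsts P := by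
    intro k hk k' hk' hmem
    unfold firsts at hmem; rw [mem_filter] at hmem
    exact (hP _ hmem.2).2 _ hk (by simp [hk'])
  have htied : ∀ k : Fin n, k.castSucc ∈ P → tiedAt a k.val = tiedAt a' k.val := by
    intro k hk
    unfold tiedAt
    congr 1
    · by_cases h0 : k.val = 0
      · rw [if_pos h0, if_pos h0]
      · rw [if_neg h0, if_neg h0]
        unfold uExt
        have hlt : k.val - 1 < n := by omega
        rw [dif_pos hlt, dif_pos hlt]
        exact h ⟨k.val - 1, hlt⟩ (hnot' k hk _ (by simp; omega))
    · unfold uExt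
      by_cases h1 : k.val + 1 < n
      · rw [dif_pos h1, dif_pos h1]; exact h ⟨k.val + 1, h1⟩ (hnot k hk _ rfl)
      · rw [dif_neg h1, dif_neg h1]
  ext i
  unfold freeSet blindAt
  simp only [mem_filter, mem_univ, true_and]
  constructor
  · rintro ⟨hi, hb⟩
    exact ⟨hi, by rw [← htied i hi]; exact hb⟩
  · rintro ⟨hi, hb⟩
    exact ⟨hi, by rw [htied i hi]; exact hb⟩

/-- merging twice along nested fixed sets. -/
theorem merge_merge_nested {m : ℕ} {S₀ S₁ : Finset (Fin m)} (h : S₀ ⊆ S₁) (b b' u : Fin m → Bool) :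
    subcubeMerge S₀ b (subcubeMerge S₁ b' u) = subcubeMerge S₁ (subcubeMerge S₀ b b') u := by
  funext i
  unfold subcubeMerge
  by_cases h0 : i ∈ S₀
  · rw [if_pos h0, if_pos (h h0), if_pos h0]
  · rw [if_neg h0]
    by_cases h1' : i ∈ S₁
    · rw [if_pos h1', if_pos h1', if_neg h0]
    · rw [if_neg h1', if_neg h1']


/-- **S5 PROVED** (value-refined slicing sum). -/
theorem S5_holds : S5 := by
  intro n Q _ S₀ Sf good _ θ hθ hsub hloc hpart
  have h2n : (0 : ℝ) < (2 : ℝ) ^ n := by positivity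
  -- per outer value `b`: `#{u : Q (merge S₀ b u)} ≤ θ·2^n + 2^n·[¬ good b]`
  have hb : ∀ b : Fin n → Bool, ((univ.filter fun u => Q (subcubeMerge S₀ b u)).card : ℝ) ≤
      θ * (2 : ℝ) ^ n + (2 : ℝ) ^ n * (if good b then 0 else 1) := by
    intro b
    have e := RingCond.sum_card_filter_merge (Sf b) (fun u => Q (subcubeMerge S₀ b u))
    have eR : (∑ b' : Fin n → Bool, (((univ.filter fun u => Q (subcubeMerge S₀ b (subcubeMerge (Sf b) b' u))).card : ℕ) : ℝ))
        = (2 : ℝ) ^ n * ((univ.filter fun u => Q (subcubeMerge S₀ b u)).card : ℝ) := by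
      exact_mod_cast e
    have hterm : ∀ b' : Fin n → Bool,
        (((univ.filter fun u => Q (subcubeMerge S₀ b (subcubeMerge (Sf b) b' u))).card : ℕ) : ℝ) ≤
          θ * (2 : ℝ) ^ n + (2 : ℝ) ^ n * (if good b then 0 else 1) := by
      intro b'
      have hagree : ∀ i ∈ S₀, subcubeMerge S₀ b b' i = b i := by
        intro i hi; unfold subcubeMerge; rw [if_pos hi]
      obtain ⟨hSf, hgood⟩ := hloc (subcubeMerge S₀ b b') b hagree
      have hset : (univ.filter fun u => Q (subcubeMerge S₀ b (subcubeMerge (Sf b) b' u))) =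
          univ.filter fun u => Q (subcubeMerge (Sf (subcubeMerge S₀ b b')) (subcubeMerge S₀ b b') u) := by
        ext u; simp only [mem_filter, mem_univ, true_and, merge_merge_nested (hsub b), hSf]
      rw [hset]
      set a : Fin n → Bool := subcubeMerge S₀ b b' with ha
      by_cases hg : good b
      · rw [if_pos hg, mul_zero, add_zero]
        exact hpart a (hgood.2 hg)
      · rw [if_neg hg, mul_one]
        have hle : ((univ.filter fun u => Q (subcubeMerge (Sf a) a u)).card : ℝ) ≤ (2 : ℝ) ^ n := by
          have := (univ.filter fun u => Q (subcubeMerge (Sf a) a u)).card_le_univ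
          rw [Fintype.card_fun, Fintype.card_bool, Fintype.card_fin] at this
          exact_mod_cast this
        have : 0 ≤ θ * (2 : ℝ) ^ n := by positivity
        linarith
    have hsum := Finset.sum_le_sum fun b' (_ : b' ∈ (univ : Finset (Fin n → Bool))) => hterm b'
    rw [eR, sum_const, card_univ, Fintype.card_fun, Fintype.card_bool, Fintype.card_fin, nsmul_eq_mul] at hsum
    push_cast at hsum
    exact le_of_mul_le_mul_left (by linarith) h2n
  -- sum over `b`
  have e1 := RingCond.sum_card_filter_merge S₀ Q
  have e1R : (∑ b : Fin n → Bool, (((univ.filter fun u => Q (subcubeMerge S₀ b u)).card : ℕ) : ℝ))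
      = (2 : ℝ) ^ n * ((univ.filter Q).card : ℝ) := by exact_mod_cast e1
  have hsum := Finset.sum_le_sum fun b (_ : b ∈ (univ : Finset (Fin n → Bool))) => hb b
  rw [e1R, sum_add_distrib, sum_const, card_univ, Fintype.card_fun, Fintype.card_bool, Fintype.card_fin, nsmul_eq_mul, ← mul_sum] at hsum
  have hboole : (∑ b : Fin n → Bool, (if good b then (0 : ℝ) else 1)) = ((univ.filter fun a => ¬ good a).card : ℝ) := by
    rw [← Finset.sum_boole]
    refine Finset.sum_congr rfl fun b _ => ?_
    by_cases hg : good b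
    · rw [if_pos hg, if_neg (not_not.2 hg)]
    · rw [if_neg hg, if_pos hg]
  rw [hboole] at hsum
  push_cast at hsum
  have : (2 : ℝ) ^ n * ((univ.filter Q).card : ℝ) ≤ (2 : ℝ) ^ n * (θ * (2 : ℝ) ^ n + ((univ.filter fun a => ¬ good a).card : ℝ)) := by
    linarith
  exact le_of_mul_le_mul_left this h2n

/-- `freeSet_subset_firsts` (planner qa-qnc0-p1 g36, PairSliceSkeleton36.lean). -/
theorem freeSet_subset_firsts (γ : Fin (n + 1) → ZMod 3) (P : Finset (Fin (n + 1))) (a : Fin n → Bool) :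
    freeSet γ P a ⊆ firsts P := by
  intro i hi
  unfold freeSet at hi; unfold firsts
  rw [mem_filter] at hi ⊢
  exact ⟨hi.1, hi.2.1⟩

/-- **COMPOSITION (proved): the five stubs give `PairAlignedHard`.** -/
theorem pairAlignedHard_of (h1 : S1) (h2 : S2) (h3 : S3) (h4 : S4) (h5 : S5) : PairAlignedHard := by
  intro c₀
  by_cases hc₀ : c₀ = 0
  · refine ⟨0, by norm_num, fun C => ⟨1, fun N hN β c γ P hP hPc => ?_⟩⟩
    subst hc₀; omega
  have hc₀pos : (0 : ℝ) < c₀ := by exact_mod_cast Nat.pos_of_ne_zero hc₀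
  set δ₀ : ℝ := 1 - 1 / (4 * c₀) with hδ₀
  have hδ₀1 : δ₀ < 1 := by
    have : 0 < 1 / (4 * (c₀ : ℝ)) := by positivity
    linarith
  obtain ⟨θw, hθw, hwalk⟩ := walkHardAllSubcube hδ₀1
  set θ' : ℝ := max θw 0 with hθ'
  have hθ'1 : θ' < 1 := max_lt hθw (by norm_num)
  have hθ'0 : 0 ≤ θ' := le_max_right _ _
  refine ⟨(1 + θ') / 2, by linarith, fun C => ?_⟩
  obtain ⟨n₁, hn₁⟩ := hwalk (2 * C + 1)
  obtain ⟨n₂, hn₂⟩ := h4 ((1 - θ') / 2) (by linarith) c₀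
  refine ⟨max (max (n₁ + 1) (n₂ + 1)) (4 ^ 3 + 1), fun N hN β c γ P hP hPc hγ0 hγ1 hmis => ?_⟩
  obtain ⟨n, rfl⟩ : ∃ n, N = n + 1 := ⟨N - 1, by have := le_max_right (max (n₁ + 1) (n₂ + 1)) (4 ^ 3 + 1); omega⟩
  have hn₁n : n₁ ≤ n := by
    have := le_trans (le_max_left _ _) (le_trans (le_max_left _ _) hN); omega
  have hn₂n : n₂ ≤ n := by
    have := le_trans (le_max_right _ _) (le_trans (le_max_left _ _) hN); omega
  have hn64 : 4 ^ 3 ≤ n := by have := le_trans (le_max_right _ _) hN; omega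
  have hn2 : 2 ≤ n := le_trans (by norm_num) hn64
  rw [show n + 1 - 1 = n from rfl]
  -- S1: pass to the walk game
  have hS1 := h1 n hn2 β c
  -- S5 with the value-refined partition
  set Q : (Fin n → Bool) → Prop := fun u => ringWinU (n + 2) (yOf β c) u = true with hQ
  set Sf : (Fin n → Bool) → Finset (Fin n) := fun a => univ \ freeSet γ P a with hSf
  set good : (Fin n → Bool) → Prop := fun a => P.card ≤ 4 * (freeSet γ P a).card with hgood
  have hsub : ∀ a, univ \ firsts P ⊆ Sf a := fun a =>
    sdiff_subset_sdiff (subset_refl _) (freeSet_subset_firsts γ P a)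
  have hloc : ∀ a a', (∀ i ∈ univ \ firsts P, a i = a' i) → Sf a = Sf a' ∧ (good a ↔ good a') := by
    intro a a' h
    have hfs : freeSet γ P a = freeSet γ P a' :=
      h2 n γ P hP a a' fun i hi => h i (mem_sdiff.2 ⟨mem_univ _, hi⟩)
    simp only [hSf, hgood, hfs, and_self]
  have hpart : ∀ a, good a → ((univ.filter fun u => Q (subcubeMerge (Sf a) a u)).card : ℝ) ≤ θ' * (2 : ℝ) ^ n := by
    intro a ha
    have hcard : ((Sf a).card : ℝ) ≤ δ₀ * n := by
      have h1' : (Sf a).card = n - (freeSet γ P a).card := by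
        simp only [hSf, card_univ_sdiff, Fintype.card_fin]
      have hle : (freeSet γ P a).card ≤ n := by
        simpa using (freeSet γ P a).card_le_univ
      have hgood' : P.card ≤ 4 * (freeSet γ P a).card := ha
      have hR : ((Sf a).card : ℝ) = n - (freeSet γ P a).card := by
        rw [h1']; push_cast [Nat.cast_sub hle]; ring
      rw [hR, hδ₀]
      have hf : ((n : ℝ) + 1) ≤ c₀ * (4 * ((freeSet γ P a).card : ℝ)) := by
        have : ((n + 1 : ℕ) : ℝ) ≤ ((c₀ * P.card : ℕ) : ℝ) := by exact_mod_cast hPc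
        have h' : ((P.card : ℕ) : ℝ) ≤ ((4 * (freeSet γ P a).card : ℕ) : ℝ) := by exact_mod_cast hgood'
        push_cast at this h' ⊢
        nlinarith
      have h4c : (0 : ℝ) < 4 * c₀ := by positivity
      have key : (n : ℝ) / (4 * c₀) ≤ (freeSet γ P a).card := by
        rw [div_le_iff₀ h4c]; nlinarith
      have : (1 - 1 / (4 * (c₀ : ℝ))) * n = n - n / (4 * c₀) := by field_simp
      rw [this]; linarith
    have hdeg : ∀ g, HasDeg (fun u => yOf β c g (subcubeMerge (Sf a) a u)) ((Nat.log 2 n) ^ (2 * C + 1)) :=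
      fun g => h3 n hn64 C β c γ P hP hmis a g
    have hw := hn₁ n hn₁n (n + 2) (Sf a) a hcard (yOf β c) hdeg
    calc ((univ.filter fun u => Q (subcubeMerge (Sf a) a u)).card : ℝ) ≤ θw * (2 : ℝ) ^ n := hw
      _ ≤ θ' * (2 : ℝ) ^ n := mul_le_mul_of_nonneg_right (le_max_left _ _) (by positivity)
  have h5' := h5 n Q (univ \ firsts P) Sf good θ' hθ'0 hsub hloc hpart
  -- S4: the bad parts
  have hbad : ((univ.filter fun a => ¬ good a).card : ℝ) ≤ (1 - θ') / 2 * (2 : ℝ) ^ n := by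
    have heq : (univ.filter fun a => ¬ good a) = univ.filter fun a : Fin n → Bool => 4 * (freeSet γ P a).card < P.card := by
      ext a; simp only [hgood, mem_filter, mem_univ, true_and, not_le]
    rw [heq]
    exact hn₂ n hn₂n γ P hP hPc hγ0 hγ1
  have hS1R : (affWinCard β c : ℝ) ≤ ((univ.filter Q).card : ℝ) := by exact_mod_cast hS1
  calc (affWinCard β c : ℝ) ≤ ((univ.filter Q).card : ℝ) := hS1R
    _ ≤ θ' * (2 : ℝ) ^ n + ((univ.filter fun a => ¬ good a).card : ℝ) := h5'
    _ ≤ θ' * (2 : ℝ) ^ n + (1 - θ') / 2 * (2 : ℝ) ^ n := by linarith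
    _ = (1 + θ') / 2 * (2 : ℝ) ^ n := by ring


/-- **`PairAlignedHard` — PROVED** (pair slicing: S1, S2, S5 by the planner; S3, S4 by the prover). -/
theorem pairAlignedHard : PairAlignedHard := pairAlignedHard_of S1_holds S2_holds s3_holds s4_holds S5_holds

end PairSkel

end Summit.QuantumAdvantage.AdviceFreeQNC0.AffBells36

end
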